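/- Copyright: the b2b-balaban cell (near-miss cell 7), T⁴-continuum fan-out, lineage t4-ne7b-p1 (node U5c COUNT
member).  Released under the licence of the surrounding project. -/
import Summits.QuantumFields.BalabanUV.T4Continuum.Support.HistorySocket
import Literature.MathematicalPhysics.QuantumFieldTheory.Balaban1983to89.T4Continuum
import Literature.MathematicalPhysics.QuantumFieldTheory.Balaban1983to89.DagBinding
import Literature.MathematicalPhysics.QuantumFieldTheory.Balaban1983to89.B14FlowStep

/-!
# History flow: the exit's typed-flow binders along Bałaban's TUNED runs (swarm row S8 = leaf F•)

Summits-side support leaf of the T⁴-continuum cell (rung (B)+1 on a FINITE torus only; NOT infinite volume, NOT the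
mass gap, NOT the Clay statement; NOT a proof of the spine estimate NE7b).  Lineage `t4-ne7b-p1` (generation 22),
node U5c; row S8 of the swarm claim table `t4/b2b-balaban-t4-ne7b-p1/LEAVES-NE7b.md` (leaf F• of
`SKELETON-NE7b-P1.md` §2).  [folklore] bookkeeping over tree declarations; nothing is quoted from print and nothing
printed is asserted; no `[cite:]` tag; no `def`.

WHY.  The exit over the history socket (`HistorySocket.relWeightBound_of_liveHistories` ∕ `hybridNE7_of_liveHistories`)
displays FIVE typed-flow binders on the runs' couplings `g K s` and sizes `R K s`: `h27` ((2.7), exponent `C.p₀`), `h29`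
((2.9)), `hR` ((2.5), exponent `rr`), `hx1` (`1 ≤ log g⁻²`), `hir` (`irThresholdZ … ≤ log g_K⁻²` at the FINAL scale).  For
the runs the T⁴ targets speak about — `D.C ⟨K, F.m, g₀ K⟩` of a `T4Continuum.FiniteEpsData` along bare couplings `g₀`
TUNED to a renormalised coupling `g` within `]0, γ]` (`FiniteEpsData.Tuned`) — they are not free-standing: (2.6)–(2.9)
follow from (0.20) and two-sided β-bounds (tree `B14FlowStep.flowControl_of_betaSign`), (0.20) follows from forward
generation (`DagBinding.ForwardGenerated`) once `1∕g_k² > β_{k+1}`, the β-bounds on the boxes are what `BetaPertHyp`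
delivers (`FlowStep.betaAFH_of_pert`, `betaUpperH_of_pert`), sizes obeying (2.5) exist (`B14FlowStep.isRj_exists`), and
under tuning `g K K = g` for every `K`, so `hir` is ONE smallness condition on the renormalised coupling, K-uniform.

WHAT.  §1 `SmallnessFor` is antitone in the exponent and satisfiable by all small `γ` (with `γ²β′ < 1`).  §2 one run of a
forward-generated construction inside `]0, γ]`: (0.20), hence (2.6)∧(2.7), (2.9) for sizes obeying (2.5), `1 ≤ log g_s⁻²`;
sizes exist.  §3 `BetaPertHyp` as two-sided box bounds.  §4 `h27`∕`h29`∕`hx1` (+ `g K K = g`) along a tuned sequence for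
EVERY size function obeying (2.5); `hir` from `g ≤ e^{−x∕2}`.  §5 **the exit and the seam form over the socket ALONG THE
TUNED RUNS**: `h27 h29 hx1 hir` REPLACED by the β-box bounds, the numeric smallness of `γ`, tuning, the smallness of `g`;
`hR` stays a checkable side condition on the size function the socket is built over (inhabited, §2).  §6 the flow side
of §5 discharged from `BetaPertHyp` in the T⁴ targets' quantifier order (`∃ γ₁ > 0, ∀ γ ≤ γ₁, …`).

HONEST.  This re-expresses displayed binders through other displayed binders (BetaPertHyp's content, tuning); it proves
no estimate of Bałaban's and discharges nothing of (B) ∕ BetaPertH ∕ the reading (ID).  NE7b NOT proved.  HONEST DEPENDENCY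
(cell): continuum YM on T⁴ ⇐ BetaPertH ∧ nine spine estimates (0/9 proved); BetaPertH ⇐ (D1) ∧ (D4) ∧ CAP+tail. -/

open Finset
open Literature.MathematicalPhysics.QuantumFieldTheory.Balaban1983to89
open T4PersistenceDictionary T4PersistentHistoryCount T4PrintedShapeBanking T4WeightBudget T4GlobalDenominator
open T4LiveClassFibration T4LiveStructureGas T4RecordPriceSeam T4IndicatorShell T4MatchingAssembly T4MatchingClosure
open T4MatchingClosureSocket T4Continuum
open Summit.QuantumFields.BalabanUV.T4Continuum.CountThresholdUniform
open Summit.QuantumFields.BalabanUV.T4Continuum.CountSeamJunction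
open Summit.QuantumFields.BalabanUV.T4Continuum.HistorySocket

namespace Summit.QuantumFields.BalabanUV.T4Continuum.HistoryFlow

noncomputable section

/-! ## §1 Smallness bookkeeping -/

section Smallness

variable {γ β' β₀ : ℝ} {L p p' : ℕ}

/-- `SmallnessFor` is antitone in the exponent. [folklore] -/
theorem smallnessFor_antitone (hp : p' ≤ p) (S : B14FlowStep.SmallnessFor γ β' β₀ L p) :
    B14FlowStep.SmallnessFor γ β' β₀ L p' where
  γ_pos := S.γ_pos
  γ_lt_one := S.γ_lt_one
  β'_nonneg := S.β'_nonneg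
  β₀_pos := S.β₀_pos
  β₀_le_one := S.β₀_le_one
  h26c := S.h26c
  h27c := S.h27c
  h27a := by
    have h : (p' : ℝ) ≤ p := by exact_mod_cast hp
    linarith [S.h27a]
  h27b := by
    have h : (p' : ℝ) ≤ p := by exact_mod_cast hp
    have h' : β₀ * Real.log (γ ^ 2)⁻¹ ≥ p := S.h27b
    linarith
  hL := S.hL
  h29c := S.h29c

/-- **`SmallnessFor` IS SATISFIABLE BY ALL SMALL `γ`** for every `β′ ≥ 0`, `0 < β₀ ≤ 1`, `L ≥ 2` with `Lβ₀ ≤ 1` and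
every exponent `p` — together with the strict companion `γ²β′ < 1` (what forward generation needs).  Explicit:
`γ₁ = min (e^{−(2p+1+p∕(2β₀))}) (√(β₀∕(β′+1)))`. [folklore] -/
theorem exists_smallnessFor (hβ' : 0 ≤ β') (hβ₀ : 0 < β₀) (hβ₁ : β₀ ≤ 1) (hL : 2 ≤ L) (hLβ : (L : ℝ) * β₀ ≤ 1)
    (p : ℕ) : ∃ γ₁ : ℝ, 0 < γ₁ ∧ ∀ γ : ℝ, 0 < γ → γ ≤ γ₁ →
      B14FlowStep.SmallnessFor γ β' β₀ L p ∧ γ ^ 2 * β' < 1 := by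
  set M : ℝ := 2 * p + 1 + p / (2 * β₀) with hM
  have hMp : 0 < M := by rw [hM]; positivity
  set γ₁ : ℝ := min (Real.exp (-M)) (Real.sqrt (β₀ / (β' + 1))) with hγ₁
  have hγ₁pos : 0 < γ₁ := lt_min (Real.exp_pos _) (Real.sqrt_pos.mpr (by positivity))
  refine ⟨γ₁, hγ₁pos, fun γ hγ hγle => ?_⟩
  have hlog : 2 * M ≤ Real.log (γ ^ 2)⁻¹ := by
    rw [B14FlowStep.log_inv_sq]
    have h1 : Real.log γ ≤ Real.log γ₁ := Real.log_le_log hγ hγle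
    have h2 : Real.log γ₁ ≤ -M := by
      calc Real.log γ₁ ≤ Real.log (Real.exp (-M)) := Real.log_le_log hγ₁pos (min_le_left _ _)
        _ = -M := Real.log_exp _
    linarith
  have hsq : γ ^ 2 ≤ β₀ / (β' + 1) := by
    calc γ ^ 2 ≤ γ₁ ^ 2 := pow_le_pow_left₀ hγ.le hγle 2
      _ ≤ (Real.sqrt (β₀ / (β' + 1))) ^ 2 :=
          pow_le_pow_left₀ hγ₁pos.le (min_le_right _ _) 2
      _ = β₀ / (β' + 1) := Real.sq_sqrt (by positivity)
  have hγβ : γ ^ 2 * β' ≤ β₀ * (β' / (β' + 1)) := by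
    calc γ ^ 2 * β' ≤ β₀ / (β' + 1) * β' := mul_le_mul_of_nonneg_right hsq hβ'
      _ = β₀ * (β' / (β' + 1)) := by ring
  have hfrac : β' / (β' + 1) < 1 := by rw [div_lt_one (by positivity)]; linarith
  have hγβ₀ : γ ^ 2 * β' ≤ β₀ := by
    have : β₀ * (β' / (β' + 1)) ≤ β₀ * 1 := mul_le_mul_of_nonneg_left hfrac.le hβ₀.le
    linarith
  have hγ1 : γ < 1 := by
    have : γ₁ ≤ Real.exp (-M) := min_le_left _ _
    have : Real.exp (-M) < 1 := Real.exp_lt_one_iff.mpr (by linarith)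
    linarith
  refine ⟨⟨hγ, hγ1, hβ', hβ₀, hβ₁, ?_, ?_, ?_, ?_, hL, hLβ⟩, ?_⟩
  · nlinarith
  · linarith
  · have hnn : (0 : ℝ) ≤ p / (2 * β₀) := by positivity
    have h4 : (4 : ℝ) * p + 2 ≤ 2 * M := by rw [hM]; linarith
    linarith
  · have h1 : (p : ℝ) ≤ β₀ * (2 * M) := by
      have heq : β₀ * (2 * (2 * p + 1 + p / (2 * β₀))) = β₀ * (4 * p + 2) + p := by
        field_simp
        ring
      have hnn : (0 : ℝ) ≤ β₀ * (4 * p + 2) := by positivity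
      rw [hM, heq]
      linarith
    exact h1.trans (mul_le_mul_of_nonneg_left hlog hβ₀.le)
  · have : β₀ * (β' / (β' + 1)) < 1 := by
      calc β₀ * (β' / (β' + 1)) ≤ 1 * (β' / (β' + 1)) := mul_le_mul_of_nonneg_right hβ₁ (by positivity)
        _ < 1 := by rw [one_mul]; exact hfrac
    linarith

end Smallness

/-! ## §2 One run of a forward-generated construction inside `]0, γ]` -/

section OneRun

variable (C : B12.Construction) (β : FlowStep.HBeta)

/-- **(0.20) ALONG A RUN FROM FORWARD GENERATION**: if the runs of `C` are generated forward by the history family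
`β` which the runs' β-functions curry, `β ≤ β′` on the boxes `]0, γ₀]^{k+1}`, and the run `P` stays in `]0, γ]` with
`γ ≤ γ₀`, `γ²β′ < 1` (so `1∕g_k² − β_{k+1} > 0` at every step), then the run satisfies the recursion (0.20) up to
`P.K`. [folklore] -/
theorem satisfiesRG_of_forwardGenerated (hcur : DagBinding.CurriesHBeta C β) (hgen : DagBinding.ForwardGenerated C β)
    {γ₀ γ β' : ℝ} (hhi : FlowStep.BetaUpperH β' γ₀ β) (hγ : γ ≤ γ₀) (hγβ : γ ^ 2 * β' < 1)
    (P : B12.RunParams) (hI : (C P).flow.InInterval γ P.K) : (C P).flow.SatisfiesRG P.K := by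
  intro k hk
  have hγpos : 0 < γ := lt_of_lt_of_le (hI 0 (Nat.zero_le _)).1 (hI 0 (Nat.zero_le _)).2
  have hpos : ∀ i, i ≤ k → 0 < (C P).flow.g i := fun i hi => (hI i (hi.trans hk.le)).1
  have hbox : FlowStep.prefixOf (C P).flow.g k ∈ FlowStep.Box γ₀ k := by
    rw [FlowStep.mem_box]
    intro i
    have hi : (i : ℕ) ≤ k := Nat.lt_succ_iff.mp i.isLt
    exact ⟨(hI i (hi.trans hk.le)).1, (hI i (hi.trans hk.le)).2.trans hγ⟩
  have hβle : β k (FlowStep.prefixOf (C P).flow.g k) ≤ β' := hhi k _ hbox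
  have hgk : 0 < (C P).flow.g k := hpos k le_rfl
  have hgkγ : (C P).flow.g k ≤ γ := (hI k hk.le).2
  have hinv : 1 / γ ^ 2 ≤ 1 / ((C P).flow.g k) ^ 2 := by
    rw [one_div_le_one_div (by positivity) (by positivity)]
    exact pow_le_pow_left₀ hgk.le hgkγ 2
  have hβ'lt : β' < 1 / γ ^ 2 := by
    rw [lt_div_iff₀ (by positivity)]; linarith
  have hrhs : 0 < 1 / ((C P).flow.g k) ^ 2 - β k (FlowStep.prefixOf (C P).flow.g k) := by linarith
  obtain ⟨-, heq⟩ := hgen.2 P k hk hpos hrhs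
  rw [hcur P k _ hk, DagBinding.update_prefixOf_last]
  linarith

variable {C β}

/-- The two-sided β-bounds AT THE POINTS `g_j` of a run inside `]0, γ]`, from box bounds under the dictionary (tree
`DagBinding.betaBoundsInInterval_of_boxBounds` + `alongRun_of_inInterval`). [folklore] -/
theorem betaAlong_of_boxBounds (hcur : DagBinding.CurriesHBeta C β) {γ₀ γ b β' : ℝ}
    (hlo : FlowStep.BetaLowerH b γ₀ β) (hhi : FlowStep.BetaUpperH β' γ₀ β) (hγ : γ ≤ γ₀) (P : B12.RunParams)
    (hI : (C P).flow.InInterval γ P.K) :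
    (∀ j, j < P.K → b ≤ (C P).flow.β (j + 1) ((C P).flow.g j)) ∧
      ∀ j, j < P.K → (C P).flow.β (j + 1) ((C P).flow.g j) ≤ β' :=
  DagBinding.alongRun_of_inInterval C (DagBinding.betaBoundsInInterval_of_boxBounds C β hcur hlo hhi) hγ P hI

/-- **(2.6) ∧ (2.7) ∧ (2.9) ALONG A RUN** of a forward-generated construction inside `]0, γ]`, from NONNEGATIVE lower
and `β′` upper box bounds on the β-family and `SmallnessFor γ β′ β₀ L p` (+ `γ²β′ < 1`), for any sizes `R` obeying
(2.5) with the same exponent `p` (tree `B14FlowStep.flowControl_of_betaSign`). [folklore] -/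
theorem flowIneqs_of_run (hcur : DagBinding.CurriesHBeta C β) (hgen : DagBinding.ForwardGenerated C β)
    {γ₀ γ b β' β₀ : ℝ} {L p : ℕ} (hb : 0 ≤ b) (hlo : FlowStep.BetaLowerH b γ₀ β)
    (hhi : FlowStep.BetaUpperH β' γ₀ β) (hγ : γ ≤ γ₀) (hγβ : γ ^ 2 * β' < 1)
    (S : B14FlowStep.SmallnessFor γ β' β₀ L p) (P : B12.RunParams) (hI : (C P).flow.InInterval γ P.K)
    (R : ℕ → ℕ) (hR : ∀ j, j ≤ P.K → B14.IsRj L p ((C P).flow.g j) (R j)) :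
    B14.FlowIneq26 (C P).flow.g β' β₀ P.K ∧ B14.FlowIneq27 (C P).flow.g β' β₀ p P.K ∧
      B14FlowStep.FlowIneq29 R (C P).flow.g L β' β₀ P.K := by
  have hrg := satisfiesRG_of_forwardGenerated C β hcur hgen hhi hγ hγβ P hI
  obtain ⟨hl, hu⟩ := betaAlong_of_boxBounds hcur hlo hhi hγ P hI
  obtain ⟨h26, h27, -, h29⟩ := B14FlowStep.flowControl_of_betaSign (C P).flow P.K S (A₀ := 0) le_rfl R hR hrg hI
    hu (fun j hj => hb.trans (hl j hj))
  exact ⟨h26, h27, h29⟩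

/-- `1 ≤ log g_s⁻²` along a run inside `]0, γ]` under `SmallnessFor` (`4p + 2 ≤ log γ⁻²` and monotonicity). [folklore] -/
theorem one_le_log_of_run {γ β' β₀ : ℝ} {L p : ℕ} (S : B14FlowStep.SmallnessFor γ β' β₀ L p) (P : B12.RunParams)
    (hI : (C P).flow.InInterval γ P.K) (s : ℕ) (hs : s ≤ P.K) : 1 ≤ Real.log (((C P).flow.g s) ^ 2)⁻¹ := by
  have h0 : (0 : ℝ) ≤ p := Nat.cast_nonneg p
  exact (show (1 : ℝ) ≤ 4 * p + 2 by linarith).trans (S.h27a.trans (B14FlowStep.log_inv_sq_mono (hI s hs).1 (hI s hs).2))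

/-- **SIZES OBEYING (2.5) EXIST** for every family of couplings, `L ≥ 2` (tree `B14FlowStep.isRj_exists` + choice). [folklore] -/
theorem exists_sizes {L : ℕ} (hL : 2 ≤ L) (r : ℕ) (g : ℕ → ℕ → ℝ) :
    ∃ R : ℕ → ℕ → ℕ, ∀ K s, B14.IsRj L r (g K s) (R K s) := by
  choose R hR using fun K s => B14FlowStep.isRj_exists hL r (g K s)
  exact ⟨R, hR⟩

end OneRun

/-! ## §3 The β-side of `BetaPertHyp` as box bounds on ONE box -/

/-- **`BetaPertHyp` ⇒ TWO-SIDED BOX BOUNDS** `b ≤ β ≤ β′` on the boxes `]0, γ₀]^{k+1}` with `0 < b ≤ β′` (tree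
`FlowStep.betaAFH_of_pert`, `betaUpperH_of_pert`, restricted to the smaller box).  The positive lower bound is what
`BetaPertH` with `β̄ > 0` encodes; only its SIGN is used on this row. [folklore] -/
theorem boxBounds_of_betaPertHyp {β : FlowStep.HBeta} (hβ : BetaPertHyp β) :
    ∃ γ₀ b β' : ℝ, 0 < γ₀ ∧ 0 < b ∧ b ≤ β' ∧ FlowStep.BetaLowerH b γ₀ β ∧ FlowStep.BetaUpperH β' γ₀ β := by
  obtain ⟨⟨βbar, hbar, hpert⟩, -⟩ := hβ
  obtain ⟨γa, hγa, b, hb, hlo⟩ := FlowStep.betaAFH_of_pert hbar hpert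
  obtain ⟨γu, hγu, β', hhi⟩ := FlowStep.betaUpperH_of_pert hpert
  have hγ₀ : 0 < min γa γu := lt_min hγa hγu
  have hlo' : FlowStep.BetaLowerH b (min γa γu) β := fun k v hv => hlo k v (FlowStep.box_mono (min_le_left _ _) k hv)
  have hhi' : FlowStep.BetaUpperH β' (min γa γu) β :=
    fun k v hv => hhi k v (FlowStep.box_mono (min_le_right _ _) k hv)
  -- the box `]0, min γa γu]^{1}` is inhabited, so `b ≤ β′`
  have hmem : (fun _ : Fin 1 => min γa γu) ∈ FlowStep.Box (min γa γu) 0 :=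
    FlowStep.mem_box.mpr fun _ => ⟨hγ₀, le_rfl⟩
  exact ⟨min γa γu, b, β', hγ₀, hb, (hlo' 0 _ hmem).trans (hhi' 0 _ hmem), hlo', hhi'⟩

/-! ## §4 The typed-flow binders along a TUNED sequence of runs -/

section Tuned

variable {F : T4Family} {G : Type*} [GaugeGroup G] [MeasurableSpace G] [HaarData G]

/-- `F.L ≥ 2` (the family has `L > 11`). [folklore] -/
theorem two_le_L (F : T4Family) : 2 ≤ F.L := by have := F.hL11; omega
/-- **THE FLOW BINDERS `h27`, `h29`, `hx1` OF THE EXIT ALONG A TUNED SEQUENCE** (+ the endpoint `g K K = g`).  For the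
runs `D.C ⟨K, F.m, g₀ K⟩` of a `FiniteEpsData` along bare couplings `g₀` tuned to `g` within `]0, γ]`: given box bounds
`b ≤ βfun ≤ β′` on `]0, γ₀]` with `b ≥ 0`, `γ ≤ γ₀`, `γ²β′ < 1`, `SmallnessFor γ β′ β₀ F.L p` with `p ≥ C.p₀` and
`p ≥ rr`, and ANY size function `R` obeying (2.5) with exponent `rr` along the runs, the couplings satisfy (2.7) with
exponent `p₀`, (2.9) for `R`, `1 ≤ log g_s⁻²`, for EVERY cutoff `K` (threshold `K₀ = 0`). [folklore] -/
theorem flowBinders_of_tuned (D : FiniteEpsData F G) {γ₀ γ b β' β₀ g : ℝ} {p p₀ rr : ℕ} (hb : 0 ≤ b)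
    (hlo : FlowStep.BetaLowerH b γ₀ D.βfun) (hhi : FlowStep.BetaUpperH β' γ₀ D.βfun) (hγ : γ ≤ γ₀)
    (hγβ : γ ^ 2 * β' < 1) (S : B14FlowStep.SmallnessFor γ β' β₀ F.L p) (hp₀ : p₀ ≤ p) (hrr : rr ≤ p)
    {g₀ : ℕ → ℝ} (ht : D.Tuned γ g g₀) (R : ℕ → ℕ → ℕ)
    (hR : ∀ K s, s ≤ K → B14.IsRj F.L rr ((D.C ⟨K, F.m, g₀ K⟩).flow.g s) (R K s)) :
    (∀ K, B14.FlowIneq27 (D.C ⟨K, F.m, g₀ K⟩).flow.g β' β₀ p₀ K) ∧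
      (∀ K, B14FlowStep.FlowIneq29 (R K) (D.C ⟨K, F.m, g₀ K⟩).flow.g F.L β' β₀ K) ∧
      (∀ K s, s ≤ K → 1 ≤ Real.log (((D.C ⟨K, F.m, g₀ K⟩).flow.g s) ^ 2)⁻¹) ∧
      (∀ K, (D.C ⟨K, F.m, g₀ K⟩).flow.g K = g) := by
  have S₀ := smallnessFor_antitone hp₀ S
  have Sr := smallnessFor_antitone hrr S
  refine ⟨fun K => ?_, fun K => ?_, fun K s hs => ?_, fun K => (ht K).2⟩
  · obtain ⟨Rr, hRr⟩ := exists_sizes (two_le_L F) p₀ fun K s => (D.C ⟨K, F.m, g₀ K⟩).flow.g s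
    exact (flowIneqs_of_run (C := D.C.toB12) (β := D.βfun) D.curries D.fwd hb hlo hhi hγ hγβ S₀ ⟨K, F.m, g₀ K⟩
      (ht K).1 (Rr K) fun j _ => hRr K j).2.1
  · exact (flowIneqs_of_run (C := D.C.toB12) (β := D.βfun) D.curries D.fwd hb hlo hhi hγ hγβ Sr ⟨K, F.m, g₀ K⟩
      (ht K).1 (R K) fun j hj => hR K j hj).2.2
  · exact one_le_log_of_run (C := D.C.toB12) S ⟨K, F.m, g₀ K⟩ (ht K).1 s hs

/-- `x ≤ log g⁻²` from `0 < g ≤ e^{−x∕2}` — the infrared smallness as a bound on the renormalised coupling. [folklore] -/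
theorem le_log_inv_sq_of_le_exp {x g : ℝ} (hg : 0 < g) (hle : g ≤ Real.exp (-(x / 2))) :
    x ≤ Real.log (g ^ 2)⁻¹ := by
  rw [B14FlowStep.log_inv_sq]
  have : Real.log g ≤ -(x / 2) := by
    calc Real.log g ≤ Real.log (Real.exp (-(x / 2))) := Real.log_le_log hg hle
      _ = -(x / 2) := Real.log_exp _
  linarith

/-- **`hir` ALONG A TUNED SEQUENCE IS ONE CONDITION ON THE RENORMALISED COUPLING** (`g K K = g` for every `K`). [folklore] -/
theorem hir_of_tuned (D : FiniteEpsData F G) {γ g x : ℝ} {g₀ : ℕ → ℝ} (ht : D.Tuned γ g g₀)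
    (hx : x ≤ Real.log (g ^ 2)⁻¹) (K : ℕ) : x ≤ Real.log (((D.C ⟨K, F.m, g₀ K⟩).flow.g K) ^ 2)⁻¹ := by
  rw [(ht K).2]; exact hx

end Tuned

/-! ## §5 The exit and the seam form over the socket, ALONG THE TUNED RUNS -/

section Exit

variable {F : T4Family} {G : Type*} [GaugeGroup G] [MeasurableSpace G] [HaarData G]
variable {γc κ ι : Type*} [DecidableEq γc] [DecidableEq κ] [DecidableEq ι] {l₀ vol : ℝ} {K₀ : ℕ} {π : ℕ → ι → κ}
  {T : ℕ → Finset ι} {A A' shA shB : ℕ → ℝ → ι → ℝ} {Bad' : ℕ → ℝ → Finset κ} {dead dead' : ℕ → ℝ → ι → ℝ}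
  {Fc Rf Fc' Rf' : ℕ → κ → ℝ} {nlow nup mlow mup : ℕ → ℝ → ℝ} {Cn : ℝ}
  {Cc Rr CcRec RrRec : ℕ → ℝ → ι → ℝ} {ν u s₂ c₀ r s Wsh : ℕ → ℝ}

omit [DecidableEq ι] in
/-- **NE7b's COUNT EXIT OVER THE HISTORY SOCKET, ALONG BAŁABAN'S TUNED RUNS.**
`HistorySocket.relWeightBound_of_liveHistories` for the coupling family `g K := (D.C ⟨K, F.m, g₀ K⟩).flow.g` of a
`FiniteEpsData` along bare couplings tuned to `g` within `]0, γ]`, with the typed-flow binders `h27 h29 hx1 hir`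
REPLACED by: box bounds `b ≤ βfun ≤ β′` on `]0, γ₀]` with `b ≥ 0` (⇐ `BetaPertHyp`, §3), `γ ≤ γ₀`, `γ²β′ < 1`,
`SmallnessFor γ β′ β₀ F.L p` with `p ≥ C.p₀, rr` (satisfiable for small `γ`, §1), tuning, and the infrared smallness
of the RENORMALISED coupling `irThresholdZ … ≤ log g⁻²`; the size function `R` the socket is built over keeps its (2.5)
side condition `hR` (inhabited, §2).  Every other binder verbatim; conclusion unchanged. [folklore] -/
theorem relWeightBound_of_liveHistories_tuned (D : FiniteEpsData F G) {C : T4PrintedShapeBanking.Consts} {rr : ℕ}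
    {β₀ : ℝ} (h : ThresholdOK C F.L rr β₀)
    {γ₀ γ b β' g : ℝ} {p : ℕ} (hb : 0 ≤ b) (hlo : FlowStep.BetaLowerH b γ₀ D.βfun)
    (hhi : FlowStep.BetaUpperH β' γ₀ D.βfun) (hγ : γ ≤ γ₀) (hγβ : γ ^ 2 * β' < 1)
    (S : B14FlowStep.SmallnessFor γ β' β₀ F.L p) (hp₀ : C.p₀ ≤ p) (hrr : rr ≤ p)
    {g₀ : ℕ → ℝ} (ht : D.Tuned γ g g₀)
    {Kz pz σ ε θ : ℝ} (hKz : 1 ≤ Kz) (hp : 0 ≤ pz) (h0 : 0 < σ) (h1 : σ < 1) (hε : 0 < ε) (hθ : 0 < θ)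
    (hir : irThresholdZ C Kz pz σ ε θ F.L rr β₀ ≤ Real.log (g ^ 2)⁻¹)
    (Cell : ℕ → ℕ → Finset γc) {V Λ : ℝ} (hV : 0 ≤ V) (hΛ : 0 < Λ)
    (hcell : ∀ K a, ((Cell K a).card : ℝ) ≤ V * Λ ^ a) (E Bk : ℕ → ℕ → Finset PEv)
    (hE : ∀ K j, ∀ e ∈ E K j, PEv.step e ∈ Ioc j K) (jstar : ℕ → ℕ) (hj : ∀ K, jstar K ≤ K) {c : ℝ} (hc : 0 < c)
    (hfrac : ∀ K : ℕ, c * K ≤ ((K - jstar K : ℕ) : ℝ))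
    (hA : Regeneration l₀ π T A Bad' dead Fc Rf nlow nup Cn K₀)
    (hA' : Regeneration l₀ π T A' Bad' dead' Fc' Rf' mlow mup Cn K₀) (hCn : 0 ≤ Cn)
    (R : ℕ → ℕ → ℕ) (hR : ∀ K s, s ≤ K → B14.IsRj F.L rr ((D.C ⟨K, F.m, g₀ K⟩).flow.g s) (R K s))
    {ρbar ηbar : ℝ} (hρbar : ∀ K j, ∑ b ∈ Bk K j, rho C ((D.C ⟨K, F.m, g₀ K⟩).flow.g) b ≤ ρbar)
    (hηbar : ∀ K j, ∀ t ∈ Ioc j K, ∑ e ∈ E K j with PEv.step e = t, eta C e ≤ ηbar)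
    (hrate : Λ * Real.exp (ηbar - C.κ₁) < 1) {Λ' : ℝ} (hΛ0 : 0 ≤ Λ') (hΛ1 : Λ' * Real.exp ε * Real.exp (-C.κ₁) ≤ 1)
    {live : ℕ → κ → Finset (Gen PEv)} {cellOf : ℕ → Gen PEv → γc}
    (H : LiveHistories C Kz pz σ Λ' l₀ K₀ R (fun K => (D.C ⟨K, F.m, g₀ K⟩).flow.g) Cell E Bk jstar Bad' Fc Rf Fc'
      Rf' live cellOf) :
    ∃ K₁, K₀ ≤ K₁ ∧ RelWeightBound l₀ T A A' (fun K t => if K₁ ≤ K then badOfClass π T Bad' K t else ∅)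
      (Set.indicator {K | K₁ ≤ K} (fun K => Cn * recordsBudget ρbar C.κ₁ V Λ ηbar jstar K)) := by
  obtain ⟨h27, h29, hx1, -⟩ := flowBinders_of_tuned D hb hlo hhi hγ hγβ S hp₀ hrr ht R hR
  exact relWeightBound_of_liveHistories h hKz hp h0 h1 hε hθ Cell hV hΛ hcell E Bk hE jstar hj hc hfrac hA hA' hCn
    R (fun K => (D.C ⟨K, F.m, g₀ K⟩).flow.g) (fun _ => β') (fun K _ => h27 K) (fun K _ => h29 K)
    (fun K _ s hs => hR K s hs) (fun K _ s hs => hx1 K s hs) (fun K _ => hir_of_tuned D ht hir K) hρbar hηbar hrate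
    hΛ0 hΛ1 H

/-- **… AND INTO THE SEAM, ALONG THE TUNED RUNS.**  `HistorySocket.hybridNE7_of_liveHistories` with the same
replacement.  What node U5's assembly still displays on this row after it: the β-box bounds (⇐ BetaPertHyp), the
numeric smallness of `γ`, tuning, the infrared smallness of `g`, the (2.5) side condition of the size function, the
socket `LiveHistories` (the reading (ID) + price domination), the two `Regeneration` runs (⇐ (B) via
`T4StabilitySocket` + resummation), NE7c's socket, NE7's core budget, four summable rates. [folklore] -/
theorem hybridNE7_of_liveHistories_tuned (D : FiniteEpsData F G) {C : T4PrintedShapeBanking.Consts} {rr : ℕ}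
    {β₀ : ℝ} (h : ThresholdOK C F.L rr β₀)
    {γ₀ γ b β' g : ℝ} {p : ℕ} (hb : 0 ≤ b) (hlo : FlowStep.BetaLowerH b γ₀ D.βfun)
    (hhi : FlowStep.BetaUpperH β' γ₀ D.βfun) (hγ : γ ≤ γ₀) (hγβ : γ ^ 2 * β' < 1)
    (S : B14FlowStep.SmallnessFor γ β' β₀ F.L p) (hp₀ : C.p₀ ≤ p) (hrr : rr ≤ p)
    {g₀ : ℕ → ℝ} (ht : D.Tuned γ g g₀)
    {Kz pz σ ε θ : ℝ} (hKz : 1 ≤ Kz) (hp : 0 ≤ pz) (h0 : 0 < σ) (h1 : σ < 1) (hε : 0 < ε) (hθ : 0 < θ)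
    (hir : irThresholdZ C Kz pz σ ε θ F.L rr β₀ ≤ Real.log (g ^ 2)⁻¹)
    (Cell : ℕ → ℕ → Finset γc) {V Λ : ℝ} (hV : 0 ≤ V) (hΛ : 0 < Λ)
    (hcell : ∀ K a, ((Cell K a).card : ℝ) ≤ V * Λ ^ a) (E Bk : ℕ → ℕ → Finset PEv)
    (hE : ∀ K j, ∀ e ∈ E K j, PEv.step e ∈ Ioc j K) (jstar : ℕ → ℕ) (hj : ∀ K, jstar K ≤ K) {c : ℝ} (hc : 0 < c)
    (hfrac : ∀ K : ℕ, c * K ≤ ((K - jstar K : ℕ) : ℝ))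
    (hA : Regeneration l₀ π T A Bad' dead Fc Rf nlow nup Cn K₀)
    (hA' : Regeneration l₀ π T A' Bad' dead' Fc' Rf' mlow mup Cn K₀) (hCn : 0 ≤ Cn)
    (R : ℕ → ℕ → ℕ) (hR : ∀ K s, s ≤ K → B14.IsRj F.L rr ((D.C ⟨K, F.m, g₀ K⟩).flow.g s) (R K s))
    {ρbar ηbar : ℝ} (hρbar : ∀ K j, ∑ b ∈ Bk K j, rho C ((D.C ⟨K, F.m, g₀ K⟩).flow.g) b ≤ ρbar)
    (hηbar : ∀ K j, ∀ t ∈ Ioc j K, ∑ e ∈ E K j with PEv.step e = t, eta C e ≤ ηbar)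
    (hrate : Λ * Real.exp (ηbar - C.κ₁) < 1) {Λ' : ℝ} (hΛ0 : 0 ≤ Λ') (hΛ1 : Λ' * Real.exp ε * Real.exp (-C.κ₁) ≤ 1)
    {live : ℕ → κ → Finset (Gen PEv)} {cellOf : ℕ → Gen PEv → γc}
    (H : LiveHistories C Kz pz σ Λ' l₀ K₀ R (fun K => (D.C ⟨K, F.m, g₀ K⟩).flow.g) Cell E Bk jstar Bad' Fc Rf Fc'
      Rf' live cellOf)
    (hSh : ShellWeightBound l₀ T A A' shA shB Wsh)
    (hTB : ReindexedBudget l₀ vol T (fun K t τ => A K t τ - shA K t τ) (fun K t τ => A' K t τ - shB K t τ)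
      (badOfClass π T Bad') Cc Rr CcRec RrRec ν u s₂ c₀ r s)
    (hr : Summable r) (hu : Summable u) (hs : Summable s) (hs₂ : Summable s₂) :
    ∃ K₁ K₂, K₀ ≤ K₁ ∧ HybridNE7 l₀ vol (fun K => T (K₁ + (K₂ + K))) (fun K => A (K₁ + (K₂ + K)))
      (fun K => A' (K₁ + (K₂ + K))) (fun K => badOfClass π T Bad' (K₁ + (K₂ + K)))
      (fun K => Cn * recordsBudget ρbar C.κ₁ V Λ ηbar jstar (K₁ + (K₂ + K)))
      (fun K => shA (K₁ + (K₂ + K))) (fun K => shB (K₁ + (K₂ + K))) (fun K => Wsh (K₁ + (K₂ + K)))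
      (fun K => (r (K₁ + (K₂ + K)) + u (K₁ + (K₂ + K))) + (s (K₁ + (K₂ + K)) + s₂ (K₁ + (K₂ + K)))) :=
  hybridNE7_of_eventually
    (relWeightBound_of_liveHistories_tuned D h hb hlo hhi hγ hγβ S hp₀ hrr ht hKz hp h0 h1 hε hθ hir Cell hV hΛ hcell
      E Bk hE jstar hj hc hfrac hA hA' hCn R hR hρbar hηbar hrate hΛ0 hΛ1 H)
    hSh hTB hr hu hs hs₂

end Exit

/-! ## §6 The flow side of §5, discharged from `BetaPertHyp` in the T⁴ targets' quantifier order -/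

section FromBetaPert

variable {F : T4Family} {G : Type*} [GaugeGroup G] [MeasurableSpace G] [HaarData G]

/-- **THE FLOW SIDE OF THE EXIT FROM `BetaPertHyp`.**  For a `FiniteEpsData` whose β-family satisfies `BetaPertHyp`,
every `0 < β₀ ≤ 1` with `F.L·β₀ ≤ 1` and every exponent `p`: box bounds `b ≤ βfun ≤ β′` on `]0, γ₀]` with `0 < b ≤ β′`,
and a `γ₁ ∈ ]0, γ₀]` such that every `γ ∈ ]0, γ₁]` satisfies `SmallnessFor γ β′ β₀ F.L p` and `γ²β′ < 1` — ALL flow-side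
hypotheses of `hybridNE7_of_liveHistories_tuned` hold for all small `γ`.  What remains of the five flow binders is the
infrared smallness of the renormalised coupling `g ≤ e^{−irThresholdZ∕2}` (`le_log_inv_sq_of_le_exp`) — the «γ small, then
g small» prefix of the T⁴ targets (`FiniteEpsData.UnderHypotheses`). [folklore] -/
theorem flowSide_of_betaPertHyp (D : FiniteEpsData F G) (hβ : BetaPertHyp D.βfun) {β₀ : ℝ} (hβ₀ : 0 < β₀)
    (hβ₁ : β₀ ≤ 1) (hLβ : (F.L : ℝ) * β₀ ≤ 1) (p : ℕ) :
    ∃ γ₀ b β' : ℝ, 0 < γ₀ ∧ 0 < b ∧ b ≤ β' ∧ FlowStep.BetaLowerH b γ₀ D.βfun ∧ FlowStep.BetaUpperH β' γ₀ D.βfun ∧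
      ∃ γ₁ : ℝ, 0 < γ₁ ∧ γ₁ ≤ γ₀ ∧ ∀ γ : ℝ, 0 < γ → γ ≤ γ₁ →
        B14FlowStep.SmallnessFor γ β' β₀ F.L p ∧ γ ^ 2 * β' < 1 := by
  obtain ⟨γ₀, b, β', hγ₀, hb, hbβ, hlo, hhi⟩ := boxBounds_of_betaPertHyp hβ
  obtain ⟨γ₁, hγ₁, hS⟩ := exists_smallnessFor (hb.le.trans hbβ) hβ₀ hβ₁ (two_le_L F) hLβ p
  refine ⟨γ₀, b, β', hγ₀, hb, hbβ, hlo, hhi, min γ₁ γ₀, lt_min hγ₁ hγ₀, min_le_right _ _, fun γ hγ hγle => ?_⟩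
  exact hS γ hγ (hγle.trans (min_le_left _ _))

/-- Sanity: `β₀ := 1∕F.L` is admissible in `flowSide_of_betaPertHyp`. [folklore] -/
example (D : FiniteEpsData F G) (hβ : BetaPertHyp D.βfun) (p : ℕ) :
    ∃ γ₀ b β' : ℝ, 0 < γ₀ ∧ 0 < b ∧ b ≤ β' ∧ FlowStep.BetaLowerH b γ₀ D.βfun ∧ FlowStep.BetaUpperH β' γ₀ D.βfun ∧
      ∃ γ₁ : ℝ, 0 < γ₁ ∧ γ₁ ≤ γ₀ ∧ ∀ γ : ℝ, 0 < γ → γ ≤ γ₁ →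
        B14FlowStep.SmallnessFor γ β' (1 / F.L) F.L p ∧ γ ^ 2 * β' < 1 := by
  have hL : (2 : ℝ) ≤ F.L := by exact_mod_cast two_le_L F
  refine flowSide_of_betaPertHyp D hβ (by positivity) ?_ ?_ p
  · rw [div_le_one (by linarith)]; linarith
  · rw [mul_one_div_cancel (by linarith)]
end FromBetaPert

end

end Summit.QuantumFields.BalabanUV.T4Continuum.HistoryFlow
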